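import Literature.IUT.HodgeArakelov.BadPrimeGaussianMonoidsProofs2
import Literature.IUT.HodgeTheaters.LabelsPlusMinusTorsors

/-!
# [IUTchII] Remark 3.5.3: the single-basepoint (conjugation) and multi-basepoint (`𝔽_l^±`-torsor)
# symmetrizing isomorphisms AGREE on labels — PROOF-ONLY companion

S. Mochizuki, *Inter-universal Teichmüller theory II*, §3, Remark 3.5.3 (kurims Dec-2020 manuscript p. 99
l. 9–21) [cite: Mochizuki2012, Rmk 3.5.3 p.99]. Claim key DISPUTED (D-0012). PROOF-ONLY file (abc-iut cell,
layer L6, seat abc-iut-L6-t8 gen 7; NODES residual «R353» named on the row IUTchII:Rmk3.5.3 by the L6-lead's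
fold v3.4at): NO `def`, NO instance, NO named `Prop` fact; nothing of abc-iut-L6-t1's `FlTorsorStructure`
(`LabelClassesOfCusps.lean`), abc-iut-w4-d004's Cor 3.5 (i) theorems (`BadPrimeGaussianMonoidsProofs2.lean`) or
abc-iut-L5-t4's `𝔽_l^±`-torsor vocabulary (`LabelsPlusMinus*.lean`, [IUTchI] Def 6.1 (i), Props 6.8/6.9) is
restated.

Print (p. 99 l. 11–21): "if one is willing to eliminate condition (c) [a single basepoint] …, then one may
obtain symmetrizing isomorphisms by simply applying the functors of [IUTchI], Proposition 6.8, (i), (ii), (iii);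
[IUTchI], Proposition 6.9, (i), (ii) — i.e., by passing to `𝒟`-`Θ^{ell}`-bridges or … capsules or processions.
Here, we observe that this «multi-basepoint» approach to constructing symmetrizing isomorphisms is compatible
with the single basepoint `𝔽_l^{⋊±}`-symmetric approach of Corollary 3.5, (i), relative to the evident
«forgetful functors». We leave the routine details to the reader."

What the kernel says here — the LABEL-LEVEL SHADOW of that compatibility (honest label: print's statement
concerns the symmetrizing isomorphisms of the full labeled data; the tree carries, as for Cor 3.5 (i) itself
(`ConjugateSynchronizationPrincipleNonVacuity`), their action on the set of labels `LabCusp^±(Π̂^±_v)`, and the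
«forgetful functor» is the chart `LabCusp^± ⥲ 𝔽_l`):

* `FlTorsorStructure.chart_conjAct_eq_smul` — through the chart, conjugation by `g ∈ Π̂^cor_v` (the
  SINGLE-basepoint symmetry of Cor 3.5 (i)) IS the action of the element `quotIso ḡ ∈ 𝔽_l^{⋊±}` (abc-iut-L5-t4's
  `FlPM`, the symmetry group of the MULTI-basepoint `𝔽_l^±`-torsors of [IUTchI] Def 6.1 (i) / Props 6.8, 6.9):
  `chart (conjAct g t) = (quotIso ḡ) • chart t`.
* `FlTorsorStructure.conjAct_bijective` — each conjugation relabeling is a bijection of `LabCusp^±`.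
* `FlTorsorStructure.exists_flPMTorsor_chart_mem` — the chart generates an [IUTchI] Def 6.1 (i)
  `𝔽_l^±`-torsor structure `𝒯` on `LabCusp^±(Π̂^±_v)` (`FlPMTorsor`, the orbit of the chart), AND every
  conjugation relabeling `t ↦ conjAct g t` is a member of its `Aut_±(𝒯)` (`FlPMTorsor.autPM`): the
  single-basepoint symmetrizing isomorphisms, read through the forgetful map to labels, are multi-basepoint
  `𝔽_l^{⋊±}`-symmetries — and conversely (`FlTorsorStructure.autPM_le_range_conjAct`) EVERY element of
  `Aut_±(𝒯)` arises this way (the two symmetry groups have the same image in `Perm(LabCusp^±)`).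

Nothing here bears on [IUTchIII] Cor 3.12; no side is taken; typed ≠ proved ≠ endorsed.
-/

namespace Literature.IUT.HodgeArakelov

namespace FlTorsorStructure

open Literature.IUT.HodgeTheaters BadPrimeGaussianMonoids

universe u

variable {S : BadPlaceSetting.{u}} {P : TopGroup.{u}} {T : TemperedCoverings S P} {W : PlusMinusTower T}
  {C : CuspidalInertiaData W} (F : FlTorsorStructure C)

/-- **IUTchII:Rmk3.5.3** (kurims p. 99 l. 17–20), LABEL-LEVEL SHADOW: through the chart
`LabCusp^±(Π̂^±_v) ≃ 𝔽_l` the single-basepoint symmetry (conjugation by `g ∈ Π̂^cor_v`, Cor 3.5 (i)) is the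
action of `quotIso ḡ ∈ 𝔽_l^{⋊±}` — the symmetry group of the multi-basepoint `𝔽_l^±`-torsors of [IUTchI]
Def 6.1 (i) (abc-iut-L5-t4 `FlPM`, `z ↦ ±z + λ`). [cite: Mochizuki2012, Rmk 3.5.3 p.99] -/
theorem chart_conjAct_eq_smul (g : W.Corhat) (t : LabCuspPM C W.pmHat W.pmHat) :
    F.chart (F.conjAct g t) = (F.quotIso (QuotientGroup.mk g)) • F.chart t := by
  rw [F.conjAct_chart, FlPM.smul_def, Units.smul_def, zsmul_eq_mul, add_comm]

/-- **IUTchII:Rmk3.5.3** / Cor 3.5 (i): each conjugation relabeling `t ↦ conjAct g t` is a bijection of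
`LabCusp^±(Π̂^±_v)` (inverse: conjugation by `g⁻¹`; from abc-iut-w4-d004's `conjAct_one`/`conjAct_mul`).
[cite: Mochizuki2012, Rmk 3.5.3 p.99] -/
theorem conjAct_bijective (g : W.Corhat) : Function.Bijective (F.conjAct g) := by
  refine Function.bijective_iff_has_inverse.mpr ⟨F.conjAct g⁻¹, fun t => ?_, fun t => ?_⟩
  · rw [← conjAct_mul F, inv_mul_cancel, conjAct_one F]
  · rw [← conjAct_mul F, mul_inv_cancel, conjAct_one F]

/-- **IUTchII:Rmk3.5.3** (kurims p. 99 l. 11–20) «this “multi-basepoint” approach … is compatible with the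
single basepoint `𝔽_l^{⋊±}`-symmetric approach of Corollary 3.5, (i), relative to the evident “forgetful
functors”», LABEL-LEVEL SHADOW: the chart of `F` generates an [IUTchI] Def 6.1 (i) `𝔽_l^±`-torsor structure
`𝒯` on `LabCusp^±(Π̂^±_v)` (abc-iut-L5-t4 `FlPMTorsor`: the `𝔽_l^{⋊±}`-orbit of the chart) such that EVERY
single-basepoint symmetrizing relabeling `conjAct g` is an element of `Aut_±(𝒯)` (`FlPMTorsor.autPM`, the
multi-basepoint symmetry group of [IUTchI] Props 6.8/6.9). [cite: Mochizuki2012, Rmk 3.5.3 p.99] -/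
theorem exists_flPMTorsor_chart_mem :
    ∃ 𝒯 : FlPMTorsor S.l (LabCuspPM C W.pmHat W.pmHat), F.chart ∈ 𝒯.charts ∧
      ∀ g : W.Corhat, ∃ σ : Equiv.Perm (LabCuspPM C W.pmHat W.pmHat),
        σ ∈ 𝒯.autPM ∧ ∀ t, σ t = F.conjAct g t := by
  classical
  let 𝒯 : FlPMTorsor S.l (LabCuspPM C W.pmHat W.pmHat) :=
    { charts := Set.range fun h : FlPM S.l => F.chart.trans (FlPM.toPerm S.l h)
      nonempty := ⟨F.chart.trans (FlPM.toPerm S.l 1), 1, rfl⟩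
      eq_orbit := by
        rintro e ⟨h, rfl⟩
        ext σ
        constructor
        · rintro ⟨k, rfl⟩
          refine ⟨k * h⁻¹, ?_⟩
          ext t
          simp only [Equiv.trans_apply, FlPM.toPerm_apply, mul_smul, inv_smul_smul]
        · rintro ⟨k, rfl⟩
          refine ⟨k * h, ?_⟩
          ext t
          simp only [Equiv.trans_apply, FlPM.toPerm_apply, mul_smul] }
  have hchart : F.chart ∈ 𝒯.charts := ⟨1, by ext t; simp⟩
  refine ⟨𝒯, hchart, fun g => ?_⟩
  refine ⟨Equiv.ofBijective (F.conjAct g) (F.conjAct_bijective g), ?_, fun t => rfl⟩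
  rw [FlPMTorsor.mem_autPM_iff_exists]
  exact ⟨F.chart, hchart, F.quotIso (QuotientGroup.mk g), fun t => F.chart_conjAct_eq_smul g t⟩

/-- **IUTchII:Rmk3.5.3**, converse at the label level (uses only the surjectivity of
`Π̂^cor_v ↠ Π̂^cor_v/Π̂^±_v ≅ 𝔽_l^{⋊±}`): for ANY [IUTchI] Def 6.1 (i) `𝔽_l^±`-torsor structure `𝒯` on
`LabCusp^±(Π̂^±_v)` having the chart among its charts, EVERY element of `Aut_±(𝒯)` is a single-basepoint
symmetrizing relabeling `conjAct g` for some `g ∈ Π̂^cor_v` — together with `exists_flPMTorsor_chart_mem`: the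
two symmetry groups have the SAME image in `Perm(LabCusp^±(Π̂^±_v))`.
[cite: Mochizuki2012, Rmk 3.5.3 p.99] -/
theorem autPM_le_range_conjAct (𝒯 : FlPMTorsor S.l (LabCuspPM C W.pmHat W.pmHat))
    (h𝒯 : F.chart ∈ 𝒯.charts) (σ : Equiv.Perm (LabCuspPM C W.pmHat W.pmHat)) (hσ : σ ∈ 𝒯.autPM) :
    ∃ g : W.Corhat, ∀ t, σ t = F.conjAct g t := by
  obtain ⟨h, hh⟩ := (FlPMTorsor.mem_autPM_iff 𝒯 σ).mp hσ F.chart h𝒯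
  obtain ⟨g, hg⟩ := QuotientGroup.mk_surjective (F.quotIso.symm h)
  refine ⟨g, fun t => F.chart.injective ?_⟩
  rw [hh t, F.chart_conjAct_eq_smul, hg, MulEquiv.apply_symm_apply]

end FlTorsorStructure

end Literature.IUT.HodgeArakelov
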